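import Summits.BirchSwinnertonDyer.BirchSwinnertonDyer.Theorems.ByReductionTypeAtTwoSupersingularLocalKummerOnto
import Summits.BirchSwinnertonDyer.BirchSwinnertonDyer.Theorems.ByReductionTypeAtTwoSupersingularKummerStructureBiduality
import Summits.BirchSwinnertonDyer.BirchSwinnertonDyer.Theorems.ByReductionTypeAtTwoSupersingularTowerTorsionTwo
import Literature.NumberTheory.EllipticCurves.Greenberg1989.LocalIwasawaH1Free
import Literature.NumberTheory.EllipticCurves.CoatesGreenberg1996.GoodModelKernelH1Trivial
import Literature.NumberTheory.EllipticCurves.Sprung2012.LocalIwasawaModule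
import Literature.NumberTheory.EllipticCurves.SelmerCorankControlRatProofs
import Literature.NumberTheory.EllipticCurves.ZpExtensionKroneckerWeberProofs
import Literature.NumberTheory.GaloisRepresentations.KroneckerWeberTheorem
import Literature.NumberTheory.EllipticCurves.CyclotomicZpExtension
import HarnessLib

/-!
# Route `ByReductionTypeAtTwo` (rung K4), crux `SupersingularRankZeroAtTwo` (item stmt-BirchSwinnertonDyer-19097), stub 5
# `stub_flatKernelCyclic`: **K86 `H1IwPointsModelFreeAtTwo` FROM PRINT, BY NAME** — Sprung's points model of
# `H¹_Iw(ℚ₂, T₂E)` is `Λ²`-free at a good supersingular `2`, modulo {Greenberg 1989 §3 Cor. 2, Coates–Greenberg 1996 Cor. 3.2}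
# (cell `bsd-2adic`, seat `bsd-2adic-tower-1` GEN 65, hand hK86-G; `--supports 19097`, helper)

HONEST FRAMING (D-0036/D-0054): THEOREMS ONLY (no definition, no named fact, no `sorry`, no instance). This file
ASSEMBLES the PRINT ∘ KERNEL road of `-imc`'s D-imc-86 (`Cruxes/SupersingularRankZeroAtTwo/D86H1IwFreeAtTwo.lean`,
module docstring links (1)–(4); NOT imported — the conclusion below is the body of `D86.H1IwPointsModelFreeAtTwo`
VERBATIM) into ONE theorem whose only displayed inputs are two PRINTED facts of the Literature layer:
* `hGr : Greenberg1989.localH1Dual_free_of_towerTorsion_trivial` — Greenberg 1989 §3 Cor. 2 (Adv. Stud. Pure Math. 17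
  p. 112): `E(ℚ_∞·ℚ_v)[p^∞] = 0 ⟹ Ĥ¹(ℚ_∞·ℚ_v, E[p^∞])` is `Λ`-free of rank `2` (data form; tower-1 GEN 65, p827276);
* `hCG : CoatesGreenberg1996.H1_goodModelKernel_trivial` — Coates–Greenberg 1996 Cor. 3.2 through LNM 1716:
  `H¹(L, Ŵ₀(𝔪̄)) = 0` over the cyclotomic tower (cell `b2b-bsdres`).
Everything else is kernel: link (1) `SSFlatEC.eq_zero_of_mem_localTowerPointsOfEmb_of_two_nsmul` (`E(ℚ_∞·ℚ₂)[2] = 0`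
at a good supersingular `2`); link (3) `LocalIwH1.localKummerMap_surjective` (Kummer ONTO, from `hCG` via the tree's
DERIVED record `WeierstrassCurve.CoatesGreenberg1996_H1_formalGroup_trivial_of_goodModelKernel` and Greenberg's
dévissage); link (4) `LocalIwH1.exists_toDual_bijective_of_kummerStructure` (Pontryagin biduality
`(E(ℚ_∞·ℚ₂) ⊗ ℚ₂/ℤ₂)^∨ = Hom(E(ℚ_∞·ℚ₂), ℤ₂)`) fed by `LocalIwH1.exists_localKummerMap` and its calculus; and two
pieces of bookkeeping proved here: `isCyclotomic_of_rat` (EVERY `ℤ_p`-extension of `ℚ` is the cyclotomic one —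
Kronecker–Weber, a tree THEOREM `KroneckerWeber_holds`, so K86 needs no `IsCyclotomic` binder) and the SIGN
(`moduleOfGenerator hg` lets `T` act by `z ↦ z ∘ g⁻¹ − z`, so `hGr` — convention `T ↦ conj_g − 1` — is applied at
the unit twist `κ.unitTwist (−1)` and `g⁻¹`, which have the same `ker κ`, the same tower, the same `H¹`).

RESULT ★★ `OddBlindNF.h1IwPointsModelFree_two_of_greenberg1989 (hGr) (hCG) : ‹K86 body VERBATIM›`; with t42's ★
`OddBlindNF.flatKernelCyclic_honda_two_of_h1IwFree` (p825964) the registered stub `stub_flatKernelCyclic` (v2.14) is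
`flatKernelCyclic_honda_two_of_h1IwFree (h1IwPointsModelFree_two_of_greenberg1989 hGr hCG)` — CLOSED MODULO PRINT
{Greenberg 1989 §3 Cor. 2, Coates–Greenberg 1996 Cor. 3.2}, not unconditionally. 19097 OPEN; nothing booked;
BSD is proved for no curve by any of this; typed ≠ proved.

References: [Greenberg1989] §3 Cor. 2 (p. 112); [KitajimaOtsuki2018] Prop. 3.29; [CoatesGreenberg1996] Cor. 3.2,
Props. 4.3/4.8; [GreenbergLNM1716] §2 pp. 82–84; [Sprung2012] §2, Lemma 2.3, Def. 5.9; [Washington1997] §13.1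
(`ℚ_∞` the unique `ℤ_p`-extension of `ℚ`).
-/

set_option autoImplicit false
-- the Theorems namespace of this sub repeats the summit name by design (D-0017 nested layout)
set_option linter.dupNamespace false

noncomputable section

open scoped Classical NumberField

namespace Summit.BirchSwinnertonDyer.BirchSwinnertonDyer.Theorems

open Field NumberField IsDedekindDomain WeierstrassCurve Literature.NumberTheory.EllipticCurves
  Literature.NumberTheory.EllipticCurves.ZpExtension Literature.NumberTheory.EllipticCurves.Sprung2012
  Literature.NumberTheory.GaloisRepresentations Literature.NumberTheory.EllipticCurves.Rank1Residual

namespace LocalIwH1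

/-! ### §1 Every `ℤ_p`-extension of `ℚ` is the cyclotomic one (Kronecker–Weber) -/

/-- **Every `ℤ_p`-extension of `ℚ` is cyclotomic** (`κ.IsCyclotomic` for ALL `κ : ZpExtension ℚ p`): by the
Kronecker–Weber theorem (tree theorem `KroneckerWeber_holds`) any two characters `Γ_ℚ →ₜ* ℤ_p` are `ℤ_p`-dependent
(`dependent_of_kroneckerWeber`); comparing `κ` with the cyclotomic `κ_cyc` (`CyclotomicZp.zpExtension p`), both
surjective, the coefficients are non-zero, so `ker κ = ker κ_cyc`, and `IsCyclotomic` only depends on the kernel.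
[cite: Washington1997, §13.1 (p. 264: ℚ_∞ is the unique ℤ_p-extension of ℚ) and Thm. 14.1 (Kronecker–Weber)] -/
theorem isCyclotomic_of_rat {p : ℕ} [Fact p.Prime] (κ : ZpExtension ℚ p) : κ.IsCyclotomic := by
  set κ₀ := CyclotomicZp.zpExtension p with hκ₀def
  have hκ₀ : κ₀.IsCyclotomic := CyclotomicZp.isCyclotomic_zpExtension p
  obtain ⟨a, b, hab, h⟩ := dependent_of_kroneckerWeber KroneckerWeber_holds κ.toContinuousMonoidHom
    κ₀.toContinuousMonoidHom
  simp only [coe_toContinuousMonoidHom] at h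
  -- both coefficients are non-zero (both characters are onto)
  obtain ⟨σ₁, hσ₁⟩ := κ.surjective (Multiplicative.ofAdd 1)
  obtain ⟨σ₀, hσ₀⟩ := κ₀.surjective (Multiplicative.ofAdd 1)
  simp only [coe_toContinuousMonoidHom] at hσ₁ hσ₀
  have ha : a ≠ 0 := by
    intro ha0
    have h0 := h σ₀
    rw [ha0, zero_mul, hσ₀, toAdd_ofAdd, mul_one] at h0
    exact hab.elim (fun h ↦ h ha0) (fun h ↦ h h0.symm)
  have hb : b ≠ 0 := by
    intro hb0
    have h1 := h σ₁
    rw [hb0, zero_mul, hσ₁, toAdd_ofAdd, mul_one] at h1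
    exact ha h1
  -- hence the kernels agree
  have hker : κ.kerSubgroup = κ₀.kerSubgroup := by
    ext σ
    rw [mem_kerSubgroup, mem_kerSubgroup, ← toAdd_eq_zero, ← toAdd_eq_zero]
    constructor
    · intro hσ
      have := h σ
      rw [hσ, mul_zero] at this
      exact (mul_eq_zero.mp this.symm).resolve_left hb
    · intro hσ
      have := h σ
      rw [hσ, mul_zero] at this
      exact (mul_eq_zero.mp this).resolve_left ha
  unfold ZpExtension.IsCyclotomic at hκ₀ ⊢
  rw [hker, hκ₀]

/-! ### §2 No `2`-power torsion on the local tower at a good supersingular `2` -/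

/-- `E(ℚ_∞·ℚ₂)[2^∞] = 0` for `W/ℚ` good supersingular at `2` (iterate link (1):
`SSFlatEC.eq_zero_of_mem_localTowerPointsOfEmb_of_two_nsmul`). [cite: Sprung2012, Lemma 2.3 (p. 1487)] -/
theorem eq_zero_of_mem_localTowerPointsOfEmb_of_two_pow_nsmul (W : WeierstrassCurve ℚ) [W.IsElliptic]
    [W.IsGloballyMinimal] (hss : GoodSS W 2) (κ : ZpExtension ℚ 2) {v : HeightOneSpectrum (𝓞 ℚ)}
    (hv : (2 : 𝓞 ℚ) ∈ v.asIdeal) {P : localPoints W (v.adicCompletion ℚ)}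
    (hP : P ∈ localTowerPointsOfEmb κ (closureEmb (K := ℚ) (v.adicCompletion ℚ)) W) (n : ℕ) (hn : 2 ^ n • P = 0) :
    P = 0 := by
  induction n generalizing P with
  | zero => rwa [pow_zero, one_smul] at hn
  | succ n ih =>
    rw [pow_succ', mul_smul] at hn
    exact ih hP (SSFlatEC.eq_zero_of_mem_localTowerPointsOfEmb_of_two_nsmul W hss κ hv _
      (AddSubgroup.nsmul_mem _ hP _) hn)

end LocalIwH1

namespace OddBlindNF

open LocalIwH1

/-! ### §3 ★★ K86 from print -/

/-- ★★ **K86 `H1IwPointsModelFreeAtTwo` FROM PRINT, BY NAME.** For every `W/ℚ` elliptic, globally minimal, good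
supersingular at `2`, every `ℤ₂`-extension `κ` of `ℚ`, every place `v ∋ 2` and every local lift `g` of a topological
generator (`κ(res g) = 1`), Sprung's points model of `H¹_Iw(ℚ₂, T₂E)` — the functionals `E(ℚ_∞·ℚ₂) →+ ℤ₂` with the
`Λ`-action `moduleOfGenerator … hg` — is `Λ`-free of rank `2`, GIVEN the two printed facts `hGr` (Greenberg 1989 §3
Cor. 2, data form) and `hCG` (Coates–Greenberg 1996 Cor. 3.2, good-model record). The conclusion is the body of
`D86.H1IwPointsModelFreeAtTwo` verbatim. ROAD: `κ' = κ.unitTwist (−1)` has the same kernel, tower and `H¹` and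
`κ'(res g⁻¹) = 1`; every `κ'` over `ℚ` is cyclotomic (§1), so `hCG` gives Coates–Greenberg for `(ker κ')_v` through
`CoatesGreenberg1996_H1_formalGroup_trivial_of_goodModelKernel`, and `GoodSS` gives good + supersingular reduction at `v`
(`hasGoodReductionAt_of_hasGoodReductionAtPrime`, `hasUnitRootAt_iff_not_dvd_frobeniusTrace`); the local Kummer map
(`exists_localKummerMap`) is then a Kummer structure onto `H¹((ker κ')_v, E(ℚ̄_v)[2^∞])` (`localKummerMap_add/zero/
succ/ker/surjective`), whose biduality (`exists_toDual_bijective_of_kummerStructure`) identifies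
`X = Hom(E(ℚ_∞·ℚ_v), ℤ₂)` with the Pontryagin dual, `T = z ↦ z∘g⁻¹ − z` matching `conj_{g⁻¹}` (`localKummerMap_conj`);
`E(ℚ_∞·ℚ_v)[2^∞] = 0` (§2) is Greenberg's hypothesis `A*(K_∞) = 0`; `hGr` concludes. Stub 5 is then
`flatKernelCyclic_honda_two_of_h1IwFree (h1IwPointsModelFree_two_of_greenberg1989 hGr hCG)` — closed MODULO PRINT, not
unconditionally. [cite: Greenberg1989, §3 Corollary 2 (p. 112)] [cite: CoatesGreenberg1996, Cor. 3.2 (through GreenbergLNM1716, p. 83)]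
[cite: GreenbergLNM1716, §2 pp. 82–84] [cite: Sprung2012, §2 p. 1486, Lemma 2.3, Def. 5.9] [cite: KitajimaOtsuki2018, Prop. 3.29] -/
theorem h1IwPointsModelFree_two_of_greenberg1989 (hGr : Greenberg1989.localH1Dual_free_of_towerTorsion_trivial)
    (hCG : CoatesGreenberg1996.H1_goodModelKernel_trivial.{0}) :
    ∀ (W : WeierstrassCurve ℚ) [W.IsElliptic] [W.IsGloballyMinimal], GoodSS W 2 →
      ∀ (κ : ZpExtension ℚ 2) (v : HeightOneSpectrum (𝓞 ℚ)), (2 : 𝓞 ℚ) ∈ v.asIdeal →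
        ∀ (g : Field.absoluteGaloisGroup (v.adicCompletion ℚ))
          (hg : κ.IsTopGenerator (resGalOfEmb (closureEmb (K := ℚ) (v.adicCompletion ℚ)) g)),
          Nonempty (letI := moduleOfGenerator κ (closureEmb (K := ℚ) (v.adicCompletion ℚ)) W hg
            (localTowerPointsOfEmb κ (closureEmb (K := ℚ) (v.adicCompletion ℚ)) W →+ ℤ_[2]) ≃ₗ[IwasawaAlgebra 2]
              (Fin 2 → IwasawaAlgebra 2)) := by
  intro W _ _ hss κ v hv g hg
  letI inst : Module (IwasawaAlgebra 2)
      (localTowerPointsOfEmb κ (closureEmb (K := ℚ) (v.adicCompletion ℚ)) W →+ ℤ_[2]) :=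
    moduleOfGenerator κ (closureEmb (K := ℚ) (v.adicCompletion ℚ)) W hg
  have hpv : ((2 : ℕ) : 𝓞 ℚ) ∈ v.asIdeal := by exact_mod_cast hv
  -- the unit twist `κ' = (−1) • κ`: same kernel, same tower, `κ'(res g⁻¹) = 1`
  have hker : (κ.unitTwist (-1)).kerSubgroup = κ.kerSubgroup := kerSubgroup_unitTwist κ (-1)
  have hg1 : κ (resGalOfEmb (closureEmb (K := ℚ) (v.adicCompletion ℚ)) g) = Multiplicative.ofAdd 1 := hg
  have hg' : (κ.unitTwist (-1)).IsTopGenerator (resGalOfEmb (closureEmb (K := ℚ) (v.adicCompletion ℚ)) g⁻¹) := by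
    have hinv : κ ((resGalOfEmb (closureEmb (K := ℚ) (v.adicCompletion ℚ)) g)⁻¹) =
        (κ (resGalOfEmb (closureEmb (K := ℚ) (v.adicCompletion ℚ)) g))⁻¹ := map_inv κ.toContinuousMonoidHom _
    change (κ.unitTwist (-1)) (resGalOfEmb (closureEmb (K := ℚ) (v.adicCompletion ℚ)) g⁻¹) = Multiplicative.ofAdd 1
    rw [unitTwist_apply, map_inv, hinv, hg1, ← ofAdd_neg, toAdd_ofAdd, Units.val_neg, Units.val_one, mul_neg, mul_one,
      neg_neg]
  have hN : localTowerPointsOfEmb (κ.unitTwist (-1)) (closureEmb (K := ℚ) (v.adicCompletion ℚ)) W =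
      localTowerPointsOfEmb κ (closureEmb (K := ℚ) (v.adicCompletion ℚ)) W := by
    unfold localTowerPointsOfEmb
    rw [hker]
  -- the identification of the two towers and the restriction of functionals along it (kept opaque)
  obtain ⟨e, hecoe⟩ : ∃ e : localTowerPointsOfEmb (κ.unitTwist (-1)) (closureEmb (K := ℚ) (v.adicCompletion ℚ)) W ≃+
      localTowerPointsOfEmb κ (closureEmb (K := ℚ) (v.adicCompletion ℚ)) W,
      ∀ y, ((e y : localTowerPointsOfEmb κ (closureEmb (K := ℚ) (v.adicCompletion ℚ)) W) :
        localPoints W (v.adicCompletion ℚ)) = (y : localPoints W (v.adicCompletion ℚ)) :=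
    ⟨AddEquiv.addSubgroupCongr hN, fun _ ↦ rfl⟩
  obtain ⟨res, hres, hresbij⟩ :
      ∃ res : (localTowerPointsOfEmb κ (closureEmb (K := ℚ) (v.adicCompletion ℚ)) W →+ ℤ_[2]) →+
          (localTowerPointsOfEmb (κ.unitTwist (-1)) (closureEmb (K := ℚ) (v.adicCompletion ℚ)) W →+ ℤ_[2]),
        (∀ z y, res z y = z (e y)) ∧ Function.Bijective res := by
    refine ⟨{ toFun := fun z ↦ z.comp e.toAddMonoidHom, map_zero' := rfl, map_add' := fun _ _ ↦ rfl },
      fun _ _ ↦ rfl, fun z z' h ↦ ?_, fun w ↦ ⟨w.comp e.symm.toAddMonoidHom, ?_⟩⟩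
    · ext x
      have h' := DFunLike.congr_fun h (e.symm x)
      change z (e (e.symm x)) = z' (e (e.symm x)) at h'
      rwa [AddEquiv.apply_symm_apply] at h'
    · ext y
      change w (e.symm (e y)) = w y
      rw [AddEquiv.symm_apply_apply]
  -- reduction data at `v`: good and supersingular; Coates–Greenberg for `(ker κ')_v` (every `κ'` is cyclotomic)
  have hgood : W.HasGoodReductionAt v := W.hasGoodReductionAt_of_hasGoodReductionAtPrime v hpv hss.1
  have hssv : ¬ W.HasUnitRootAt v := fun h ↦
    (W.hasUnitRootAt_iff_not_dvd_frobeniusTrace v Nat.prime_two hpv).mp h hss.2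
  have hCoGr := CoatesGreenberg1996_H1_formalGroup_trivial_of_goodModelKernel hCG ℚ W 2 (κ.unitTwist (-1)) v
    (isCyclotomic_of_rat _) hpv hgood
  -- the local Kummer map for `κ'` is a Kummer structure ONTO `H¹((ker κ')_v, E[2^∞])`
  obtain ⟨κf, hκ⟩ := exists_localKummerMap (κ.unitTwist (-1)) (v.adicCompletion ℚ) W
  have hsurj := localKummerMap_surjective (κ.unitTwist (-1)) W v hpv hgood hssv hCoGr hκ
  obtain ⟨toDual₀, hbij₀, hval₀⟩ := exists_toDual_bijective_of_kummerStructure κf (localKummerMap_add hκ)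
    (localKummerMap_zero hκ) (localKummerMap_succ hκ) hsurj (localKummerMap_ker hκ)
  -- Greenberg 1989 §3 Cor. 2 at `(κ', g⁻¹)` with `X = Hom(E(ℚ_∞·ℚ_v), ℤ₂)` and `toDual = toDual₀ ∘ res`
  refine hGr W 2 (κ.unitTwist (-1)) v ?_ g⁻¹ hg'
    (localTowerPointsOfEmb κ (closureEmb (K := ℚ) (v.adicCompletion ℚ)) W →+ ℤ_[2]) (toDual₀.comp res)
    (hbij₀.comp hresbij) (fun z c ↦ ?_) (fun P hP n hn ↦ ?_)
  · exact_mod_cast hv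
  · -- `T` acts as `conj_{g⁻¹} − 1` under `toDual`
    obtain ⟨x, k, rfl⟩ := hsurj c
    -- the two points `e x` and `g⁻¹ • x` read in `E(ℚ_∞·ℚ_v)` for `κ`
    have hgx : g⁻¹ • ((e x : localTowerPointsOfEmb κ (closureEmb (K := ℚ) (v.adicCompletion ℚ)) W) :
        localPoints W (v.adicCompletion ℚ)) ∈ localTowerPointsOfEmb κ (closureEmb (K := ℚ) (v.adicCompletion ℚ)) W :=
      smul_mem_localTowerPointsOfEmb κ (closureEmb (K := ℚ) (v.adicCompletion ℚ)) W g⁻¹ (e x).2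
    have hgx' : g⁻¹ • (x : localPoints W (v.adicCompletion ℚ)) ∈
        localTowerPointsOfEmb (κ.unitTwist (-1)) (closureEmb (K := ℚ) (v.adicCompletion ℚ)) W :=
      smul_mem_localTowerPointsOfEmb (κ.unitTwist (-1)) (closureEmb (K := ℚ) (v.adicCompletion ℚ)) W g⁻¹ x.2
    have hegx : e ⟨g⁻¹ • (x : localPoints W (v.adicCompletion ℚ)), hgx'⟩ = ⟨_, hgx⟩ := by
      apply Subtype.ext
      rw [hecoe]
      change g⁻¹ • (x : localPoints W (v.adicCompletion ℚ)) =
        g⁻¹ • ((e x : localTowerPointsOfEmb κ (closureEmb (K := ℚ) (v.adicCompletion ℚ)) W) :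
          localPoints W (v.adicCompletion ℚ))
      rw [hecoe]
    obtain ⟨a, ha⟩ := ZMod.intCast_surjective (PadicInt.toZModPow k (z (e x)))
    obtain ⟨b, hb⟩ := ZMod.intCast_surjective (PadicInt.toZModPow k (z ⟨_, hgx⟩))
    have h1 := hval₀ (res z) x k a (by rw [hres, ha])
    have h2 := hval₀ (res z) ⟨g⁻¹ • (x : localPoints W (v.adicCompletion ℚ)), hgx'⟩ k b (by rw [hres, hegx, hb])
    have h3 := hval₀ (res ((PowerSeries.X : IwasawaAlgebra 2) • z)) x k (b - a) (by
      rw [hres]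
      change PadicInt.toZModPow k (lambdaSMul κ (closureEmb (K := ℚ) (v.adicCompletion ℚ)) W hg PowerSeries.X z (e x)) = _
      rw [lambdaSMul_X_apply, map_sub, ← ha, ← hb, Int.cast_sub])
    -- `conj_{g⁻¹} (κf x k) = κf (g⁻¹ x) k`, transported under `toDual₀ ∘ res` WITHOUT rewriting inside `H¹`-valued terms
    have hconj := localKummerMap_conj hκ g⁻¹ x k
    have h2' := (congrArg ((toDual₀.comp res) z) hconj).trans h2
    have key := congrArg₂ (· - ·) h2' h1
    refine (h3.trans ?_).trans key.symm
    rw [Int.cast_sub, sub_div, AddCircle.coe_sub]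
  · -- `E(ℚ_∞·ℚ_v)[2^∞] = 0`
    rw [hN] at hP
    exact eq_zero_of_mem_localTowerPointsOfEmb_of_two_pow_nsmul W hss κ hv hP n hn

end OddBlindNF

end Summit.BirchSwinnertonDyer.BirchSwinnertonDyer.Theorems

end
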